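import Summits.AtomisticToContinuum.BoseEinsteinCondensation.Theorems.InfraredMinimumUncertainty.Negative.FreeDensityWaveBragg
import Summits.AtomisticToContinuum.BoseEinsteinCondensation.Theorems.InfraredMinimumUncertainty.Negative.FreeMinimisersConstant

/-!
# Negative lemmas for crux `HardCoreExtension` (stmt-AtomisticToContinuum-11786) — line
# `third-law-current-floor`, stub S2 `stub_forceStructureBound` (CFB), I: the force structure factor
# of the free density wave (`D_{e₀} ≥ N²K²ε²/(1+2ε²)²`, a coherent `N²`)

Supports (does not close) stmt-AtomisticToContinuum-11786 (route `BECConjugateDomination`); drefute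
seat on the picked line `Cruxes/HardCoreExtension/Lines/third-law-current-floor.lean`.

The line's load-bearing stub S2 asserts, for every bounded admissible `v` of range `≤ R` and every
positive real EXACT minimiser `Ψ` of the periodic `(n+1)`-body energy on the torus of side
`L = ((n+1)/ρ)^{1/3}`, the force-structure bound
`D_k := ∫_{cell^N} |∑ⱼ e_m(xⱼ) (k·∇ⱼ)Ψ|² ≤ C ρ |k|² (n+1)` (`k = 2πm/L`, `m ≠ 0`), `C = C(R)`,
`ρ < ρ₀(R)`, eventually in `n`.  This file (I of II) evaluates the left-hand side on the positive
real density wave `Ψ_ε = (c(1 + 2ε cos θ_{e₀}))^{⊗N}` of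
`InfraredMinimumUncertainty.Negative.waveState` (free gas), at the mode `m = e₀`, `k = (2π/L)e₀`:

* `waveVec`, `norm_waveVec`, `argCLM_waveVec`, `fderiv_waveFactorC_waveVec`;
* `forceField` (`g = (k·∇) log φ = −2εK sin θ/(1 + 2ε cos θ)`, `K = (2π/L)²`),
  `fderiv_waveFun_single` (**the force field of the product state is one-body:
  `(k·∇ⱼ)Ψ = Ψ·g(xⱼ)`**), `forceAmp` / `forceIm` (`F = ∑ⱼ e^{iθⱼ}g(xⱼ)`, `G = Im F`),
  `forceSum_waveFun` (`∑ⱼ e_{e₀}(xⱼ)(k·∇ⱼ)Ψ = Ψ·F`);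
* `integral_cell_sin_mul_forceField_mul_sq` (`∫_cell sin θ · g · φ² = −εK/(1+2ε²)`),
  `integral_forceIm_mul_norm_sq` (`∫ G|Ψ|² = −NεK/(1+2ε²)`);
* `forceStructure_waveState_ge`: **`D_{e₀} = ∫|∑ⱼ e_{e₀}(xⱼ)(k·∇ⱼ)Ψ_ε|² ≥ N²K²ε²/(1+2ε²)²`**
  (`|F| ≥ |Im F|` + weighted Jensen) — a COHERENT `N²` (density-wave order), against the `N` on the
  right-hand side of S2.  File II (`ForceStructureMinimality`) turns this into the refutation of S2
  with any fixed energy slack / without minimality.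
-/

noncomputable section

open MeasureTheory Filter Set
open scoped ENNReal NNReal Topology ComplexConjugate BigOperators

namespace Summit.AtomisticToContinuum.BoseEinsteinCondensation.Theorems.HardCoreExtension.Negative

open Literature.MathematicalPhysics.QuantumManyBody.BoseGas
open Summit.AtomisticToContinuum.BoseEinsteinCondensation.Theorems.InfraredMinimumUncertainty.Negative
  (cnorm cnorm_pos cnorm_sq_mul_cube waveFactor waveFactorC waveFactor_pos continuous_waveFactor
    contDiff_waveFactorC continuous_waveFactorC hasFDerivAt_waveFactorC waveFun waveState waveState_ψ
    norm_waveFun norm_sq_waveFun waveFun_eq_norm waveFun_ne_zero integral_cell_waveFactor_sq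
    periodicEnergy_waveState_le periodicGroundStateEnergy_free integral_cellN_prod_real
    im_cellWave)
open Summit.AtomisticToContinuum.BoseEinsteinCondensation.Theorems.GaussianDominationCan.Negative
  (prodFun contDiff_prodFun continuous_prodFun fderiv_prodFun)
open Summit.AtomisticToContinuum.BoseEinsteinCondensation.Theorems.StaticResponseBound.Negative
  (arg arg_intSMul phiMode continuous_arg continuous_phiMode phiMode_pos integral_cell_trig_combo
    argCLM argCLM_apply isRepulsiveFiniteRange_zero)
open Summit.AtomisticToContinuum.BoseEinsteinCondensation.Theorems.CorrectorClosure.Negative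
  (e0 e0_ne_zero sideLength_succ_pos)

variable {L ε : ℝ} {n : ℕ}

/-! ## The wave vector `k = (2π/L)e₀` and the force field of the density wave -/

/-- The wave vector `k = (2π/L)·e₀` of the lowest mode along the first axis (the line's
`(2π/L) • latticeVec 1 m` at `m = e₀`). -/
def waveVec (L : ℝ) : Space := (2 * Real.pi / L) • latticeVec 1 e0

/-- `‖k‖ = 2π/L`. [folklore] -/
theorem norm_waveVec (hL : 0 < L) : ‖waveVec L‖ = 2 * Real.pi / L := by
  unfold waveVec
  rw [norm_smul, Real.norm_of_nonneg (by positivity)]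
  have : ‖latticeVec 1 e0‖ = 1 := by
    rw [EuclideanSpace.norm_eq, Fin.sum_univ_three]
    simp [latticeVec, e0, Pi.single_apply]
  rw [this, mul_one]

/-- `θ_{e₀}(k) = (2π/L)²` (`= |k|²`). [folklore] -/
theorem argCLM_waveVec (L : ℝ) : argCLM L e0 (waveVec L) = (2 * Real.pi / L) ^ 2 := by
  rw [argCLM_apply]
  unfold arg waveVec
  rw [Fin.sum_univ_three]
  simp [latticeVec, e0, Pi.single_apply]
  ring

/-- The directional derivative of the one-body factor along `k`:
`(k·∇)φ_ℂ(x) = c · (−2ε sin θ(x)) · (2π/L)²`. [folklore] -/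
theorem fderiv_waveFactorC_waveVec (L ε : ℝ) (x : Space) :
    fderiv ℝ (waveFactorC L ε) x (waveVec L) =
      ((cnorm L ε * (2 * ε * -Real.sin (arg L e0 x)) * (2 * Real.pi / L) ^ 2 : ℝ) : ℂ) := by
  rw [(hasFDerivAt_waveFactorC L ε x).fderiv]
  simp [argCLM_waveVec]

/-- The (real) one-body force field of the density wave along `k`:
`g = (k·∇) log φ = −2ε (2π/L)² sin θ / (1 + 2ε cos θ)`. -/
def forceField (L ε : ℝ) (x : Space) : ℝ :=
  2 * ε * -Real.sin (arg L e0 x) * (2 * Real.pi / L) ^ 2 / phiMode L e0 ε x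

/-- `g` is continuous (`φ > 0`). [folklore] -/
@[fun_prop]
theorem continuous_forceField (hε : |ε| < 1 / 2) (L : ℝ) : Continuous (forceField L ε) := by
  unfold forceField
  exact Continuous.div (by fun_prop) (continuous_phiMode L e0 ε) fun x => (phiMode_pos hε x).ne'

/-- `φ_ℂ(x) · g(x) = (k·∇)φ_ℂ(x)`. [folklore] -/
theorem waveFactorC_mul_forceField (hε : |ε| < 1 / 2) (L : ℝ) (x : Space) :
    waveFactorC L ε x * (forceField L ε x : ℂ) = fderiv ℝ (waveFactorC L ε) x (waveVec L) := by
  rw [fderiv_waveFactorC_waveVec, waveFactorC, ← Complex.ofReal_mul]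
  congr 1
  unfold forceField waveFactor
  have hφ : phiMode L e0 ε x ≠ 0 := (phiMode_pos hε x).ne'
  field_simp

/-- **The force field of the product state is one-body**:
`(k·∇ⱼ)Ψ(X) = Ψ(X) · g(xⱼ)`. [folklore] -/
theorem fderiv_waveFun_single (hε : |ε| < 1 / 2) (X : Config (n + 1)) (j : Fin (n + 1)) :
    fderiv ℝ (waveFun n L ε) X (Pi.single j (waveVec L)) =
      waveFun n L ε X * (forceField L ε (X j) : ℂ) := by
  have hdiff : ∀ _i : Fin (n + 1), Differentiable ℝ (waveFactorC L ε) := fun _ =>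
    (contDiff_waveFactorC L ε).differentiable one_ne_zero
  unfold waveFun
  rw [fderiv_prodFun hdiff X j (waveVec L), ← waveFactorC_mul_forceField hε, ← mul_assoc]
  congr 1
  unfold prodFun
  exact Finset.prod_erase_mul _ _ (Finset.mem_univ j)

/-- The complex force amplitude `F(X) = ∑ⱼ e_{e₀}(xⱼ) g(xⱼ)` and its imaginary part
`G(X) = ∑ⱼ sin θ(xⱼ) g(xⱼ)`. -/
def forceAmp (n : ℕ) (L ε : ℝ) (X : Config (n + 1)) : ℂ :=
  ∑ j, cellWave L e0 (X j) * (forceField L ε (X j) : ℂ)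

/-- `G = Im F`. -/
def forceIm (n : ℕ) (L ε : ℝ) (X : Config (n + 1)) : ℝ :=
  ∑ j, Real.sin (arg L e0 (X j)) * forceField L ε (X j)

/-- `Im F = G`. [folklore] -/
theorem im_forceAmp (X : Config (n + 1)) : (forceAmp n L ε X).im = forceIm n L ε X := by
  unfold forceAmp forceIm
  rw [Complex.im_sum]
  refine Finset.sum_congr rfl fun j _ => ?_
  rw [Complex.im_mul_ofReal, im_cellWave]

/-- **The force-structure integrand of the density wave factorises**:
`∑ⱼ e_{e₀}(xⱼ)(k·∇ⱼ)Ψ(X) = Ψ(X)·F(X)`. [folklore] -/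
theorem forceSum_waveFun (hε : |ε| < 1 / 2) (X : Config (n + 1)) :
    ∑ j, cellWave L e0 (X j) * fderiv ℝ (waveFun n L ε) X (Pi.single j (waveVec L)) =
      waveFun n L ε X * forceAmp n L ε X := by
  unfold forceAmp
  rw [Finset.mul_sum]
  refine Finset.sum_congr rfl fun j _ => ?_
  rw [fderiv_waveFun_single hε X j]
  ring


/-! ## The lower bound `D_{e₀} ≥ N²K²ε²/(1+2ε²)²` for the density wave -/

/-- Pointwise: `G(X)²‖Ψ(X)‖² ≤ ‖Ψ(X)F(X)‖²` (`|Im F| ≤ |F|`). [folklore] -/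
theorem forceIm_sq_mul_le (X : Config (n + 1)) :
    forceIm n L ε X ^ 2 * ‖waveFun n L ε X‖ ^ 2 ≤ ‖waveFun n L ε X * forceAmp n L ε X‖ ^ 2 := by
  rw [norm_mul, mul_pow, mul_comm]
  refine mul_le_mul_of_nonneg_left ?_ (sq_nonneg _)
  rw [← im_forceAmp, sq_le_sq, abs_norm]
  exact Complex.abs_im_le_norm _

/-- `sin²θ · (1 + 2ε cos θ) = ½ + (ε/2) cos θ − ½ cos 2θ − (ε/2) cos 3θ`. [folklore] -/
theorem sin_sq_mul_phiMode (x : Space) :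
    Real.sin (arg L e0 x) ^ 2 * phiMode L e0 ε x =
      1 / 2 + ε / 2 * Real.cos (arg L e0 x) + -(1 / 2) * Real.cos (arg L ((2 : ℤ) • e0) x)
        + -(ε / 2) * Real.cos (arg L ((3 : ℤ) • e0) x) := by
  rw [arg_intSMul, arg_intSMul]
  push_cast
  unfold phiMode
  rw [Real.sin_sq, Real.cos_two_mul, Real.cos_three_mul]
  ring

/-- `∫_cell sin²θ · (1 + 2ε cos θ) = L³/2`. [folklore] -/
theorem integral_cell_sin_sq_mul_phiMode (hL : 0 < L) :
    ∫ x in cell L, Real.sin (arg L e0 x) ^ 2 * phiMode L e0 ε x = 1 / 2 * L ^ 3 := by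
  simp_rw [sin_sq_mul_phiMode]
  exact integral_cell_trig_combo hL e0_ne_zero _ _ _ _

/-- **The one-body force integral**: `∫_cell sin θ · g · φ² = −ε(2π/L)²/(1+2ε²)`. [folklore] -/
theorem integral_cell_sin_mul_forceField_mul_sq (hL : 0 < L) (hε : |ε| < 1 / 2) :
    ∫ x in cell L, Real.sin (arg L e0 x) * forceField L ε x * waveFactor L ε x ^ 2 =
      -(ε * (2 * Real.pi / L) ^ 2 / (1 + 2 * ε ^ 2)) := by
  have hpt : ∀ x, Real.sin (arg L e0 x) * forceField L ε x * waveFactor L ε x ^ 2 =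
      (-(2 * ε * (2 * Real.pi / L) ^ 2 * cnorm L ε ^ 2)) *
        (Real.sin (arg L e0 x) ^ 2 * phiMode L e0 ε x) := by
    intro x
    unfold forceField waveFactor
    have hφ : phiMode L e0 ε x ≠ 0 := (phiMode_pos hε x).ne'
    field_simp
  simp_rw [hpt]
  rw [integral_const_mul, integral_cell_sin_sq_mul_phiMode hL,
    show -(2 * ε * (2 * Real.pi / L) ^ 2 * cnorm L ε ^ 2) * (1 / 2 * L ^ 3) =
      -(ε * (2 * Real.pi / L) ^ 2 * (cnorm L ε ^ 2 * L ^ 3)) by ring,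
    cnorm_sq_mul_cube hL]
  ring

/-- `Ψ` of the density wave is continuous. [folklore] -/
theorem continuous_waveFun (L ε : ℝ) : Continuous (waveFun n L ε) :=
  (contDiff_prodFun fun _ => contDiff_waveFactorC L ε).continuous

/-- `F` is continuous. [folklore] -/
theorem continuous_forceAmp (hε : |ε| < 1 / 2) (L : ℝ) : Continuous (forceAmp n L ε) := by
  unfold forceAmp
  have := continuous_forceField hε L
  fun_prop

/-- `G` is continuous. [folklore] -/
theorem continuous_forceIm (hε : |ε| < 1 / 2) (L : ℝ) : Continuous (forceIm n L ε) := by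
  unfold forceIm
  have := continuous_forceField hε L
  fun_prop

/-- **The first moment of the force**: `∫ G |Ψ|² = −N ε (2π/L)²/(1 + 2ε²)`. [folklore] -/
theorem integral_forceIm_mul_norm_sq (hL : 0 < L) (hε : |ε| < 1 / 2) :
    ∫ X in cellN (n + 1) L, forceIm n L ε X * ‖waveFun n L ε X‖ ^ 2 =
      ((n : ℝ) + 1) * -(ε * (2 * Real.pi / L) ^ 2 / (1 + 2 * ε ^ 2)) := by
  classical
  have hterm : ∀ j : Fin (n + 1), ∫ X in cellN (n + 1) L,
      Real.sin (arg L e0 (X j)) * forceField L ε (X j) * ‖waveFun n L ε X‖ ^ 2 =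
        -(ε * (2 * Real.pi / L) ^ 2 / (1 + 2 * ε ^ 2)) := by
    intro j
    simp_rw [norm_sq_waveFun hL hε]
    set Fi : Fin (n + 1) → Space → ℝ := fun i x =>
      if i = j then Real.sin (arg L e0 x) * forceField L ε x * waveFactor L ε x ^ 2
      else waveFactor L ε x ^ 2 with hFi
    have hpt : ∀ X : Config (n + 1),
        Real.sin (arg L e0 (X j)) * forceField L ε (X j) * ∏ i, waveFactor L ε (X i) ^ 2 =
          ∏ i, Fi i (X i) := by
      intro X
      rw [← Finset.mul_prod_erase Finset.univ (fun i => waveFactor L ε (X i) ^ 2) (Finset.mem_univ j),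
        ← Finset.mul_prod_erase Finset.univ (fun i => Fi i (X i)) (Finset.mem_univ j)]
      have hFj : Fi j (X j) =
          Real.sin (arg L e0 (X j)) * forceField L ε (X j) * waveFactor L ε (X j) ^ 2 := by
        simp [hFi]
      have hFo : ∀ i ∈ Finset.univ.erase j, Fi i (X i) = waveFactor L ε (X i) ^ 2 := fun i hi => by
        simp [hFi, Finset.ne_of_mem_erase hi]
      rw [hFj, Finset.prod_congr rfl hFo]
      ring
    simp_rw [hpt]
    rw [integral_cellN_prod_real Fi,
      ← Finset.mul_prod_erase Finset.univ (fun i => ∫ x in cell L, Fi i x) (Finset.mem_univ j)]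
    have hIj : ∫ x in cell L, Fi j x = -(ε * (2 * Real.pi / L) ^ 2 / (1 + 2 * ε ^ 2)) := by
      simp only [hFi, if_true]
      exact integral_cell_sin_mul_forceField_mul_sq hL hε
    have hIi : ∀ i ∈ Finset.univ.erase j, ∫ x in cell L, Fi i x = 1 := fun i hi => by
      simp only [hFi, if_neg (Finset.ne_of_mem_erase hi)]
      exact integral_cell_waveFactor_sq hL ε
    rw [hIj, Finset.prod_eq_one hIi, mul_one]
  unfold forceIm
  simp only [Finset.sum_mul]
  have hcont : ∀ j : Fin (n + 1), Continuous fun X : Config (n + 1) =>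
      Real.sin (arg L e0 (X j)) * forceField L ε (X j) * ‖waveFun n L ε X‖ ^ 2 := by
    intro j
    have h1 := continuous_forceField hε L
    have h2 := continuous_waveFun (n := n) L ε
    fun_prop
  rw [integral_finsetSum _ fun j _ => integrableOn_cellN (hcont j) L]
  simp only [hterm, Finset.sum_const, Finset.card_univ, Fintype.card_fin, nsmul_eq_mul,
    Nat.cast_add, Nat.cast_one]

/-- **Force-structure lower bound for the density wave**: with `k = (2π/L)e₀`,
`D_{e₀} = ∫_{cell^N} |∑ⱼ e_{e₀}(xⱼ)(k·∇ⱼ)Ψ_ε|² ≥ N² ε² (2π/L)⁴ / (1 + 2ε²)²` — a coherent `N²`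
(density-wave order), against the `N` of S2's right-hand side. [folklore] -/
theorem forceStructure_waveState_ge (hL : 0 < L) (hε : |ε| < 1 / 2) :
    (((n : ℝ) + 1) * (ε * (2 * Real.pi / L) ^ 2 / (1 + 2 * ε ^ 2))) ^ 2 ≤
      ∫ X in cellN (n + 1) L,
        ‖∑ j, cellWave L e0 (X j) * fderiv ℝ (waveFun n L ε) X (Pi.single j (waveVec L))‖ ^ 2 := by
  simp_rw [forceSum_waveFun hε]
  have hG := continuous_forceIm (n := n) hε L
  have hw : Continuous fun X : Config (n + 1) => ‖waveFun n L ε X‖ ^ 2 :=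
    ((continuous_waveFun L ε).norm).pow 2
  have hJ := InfraredMinimumUncertainty.Negative.sq_integral_le_integral_sq (L := L) hG
    (waveState n hL ε)
  simp only [waveState_ψ] at hJ
  rw [integral_forceIm_mul_norm_sq hL hε] at hJ
  have hmono : ∫ X in cellN (n + 1) L, forceIm n L ε X ^ 2 * ‖waveFun n L ε X‖ ^ 2 ≤
      ∫ X in cellN (n + 1) L, ‖waveFun n L ε X * forceAmp n L ε X‖ ^ 2 :=
    integral_mono (integrableOn_cellN ((hG.pow 2).mul hw) L)
      (integrableOn_cellN (((continuous_waveFun L ε).mul (continuous_forceAmp hε L)).norm.pow 2) L)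
      fun X => forceIm_sq_mul_le X
  calc (((n : ℝ) + 1) * (ε * (2 * Real.pi / L) ^ 2 / (1 + 2 * ε ^ 2))) ^ 2
      = (((n : ℝ) + 1) * -(ε * (2 * Real.pi / L) ^ 2 / (1 + 2 * ε ^ 2))) ^ 2 := by ring
    _ ≤ _ := hJ.trans hmono


end Summit.AtomisticToContinuum.BoseEinsteinCondensation.Theorems.HardCoreExtension.Negative
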